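import Mathlib
import Summits.ValiantsHypothesis.ValiantsHypothesis.Theorems.ValuativeGCTValuativeFlipCyclicCofactor
import Summits.ValiantsHypothesis.ValiantsHypothesis.Theorems.ValuativeGCTValuativeFlipCyclicIdentities

/-!
# Membership of the clockwise pure products in the tangent span (crux `ValuativeGCT.ValuativeFlip`, stub `stub_fourRowPencilRank`)

P2 (clockwise half) of the cyclic-tridiagonal architecture for hypothesis `H` of
`fourRowPencilRank_of_pencilCertificate` (`Cruxes/ValuativeFlip/AxisK9G1a2CyclicTridiagonal.md` §3).
Setting: `K` a field with `2 ≠ 0`, sequences `l m m' : ZMod n → MvPolynomial (Fin 4) K` of LINEAR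
forms (members of `linL = span {X t}`), the cofactors `cofF i j` of the cyclic tridiagonal matrix
(row `i`, column `j` deleted; `= ∂_{ij} per` at the pencil) and the tangent span
`tanV = span_K {X t · cofF i j}`.

* `lin_mul_cofF_mem` — `λ · cofF i j ∈ tanV` for every linear form `λ`;
* `cofF_eq_Tw_add_Sw` / `cofF_diag` — the cofactor formula (file `…CyclicCofactor`) in window form;
* `lin_mul_Tw_mem` — **for every even string length `e = 2e'+2 ≤ n - 3`, every window start `q`
  and every linear form `λ`: `λ · Tw q e ∈ tanV`**, provided the four forms
  `l_{q+e}, l_q, m'_{q+e}, m'_{q+1}` span the linear forms (hypothesis `hspan`; true for the explicit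
  configuration).  Induction on `e'`: the four special multiples are combinations of
  `λ · cofF` terms and of multiples of `Tw` of length `e - 2` (identities (R2), (C2) = one
  `Tw_rowRec`/`Tw_colRec` for the clockwise parts plus one `Sw_rowRec`/`Sw_colRec` for the
  counter-clockwise parts, and (E2), (E4)).
The counter-clockwise half (`Sw`) is file `…CyclicMembershipS`. [this crux]
-/

set_option linter.dupNamespace false

namespace Summit.ValiantsHypothesis.ValiantsHypothesis.Theorems.ValuativeFlip

open MvPolynomial
open scoped BigOperators

noncomputable section

section defs

variable {K : Type*} [Field K] {n : ℕ} [NeZero n]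

/-- The cofactor of the cyclic tridiagonal matrix with row `i` and column `j` deleted. [this crux] -/
def cofF (l m m' : ZMod n → MvPolynomial (Fin 4) K) (i j : ZMod n) : MvPolynomial (Fin 4) K :=
  (cycM l m m').subperm (fun c => c ≠ j) (fun r => r ≠ i)

/-- The tangent span `span_K {X t · cofF i j}`. [this crux] -/
def tanV (l m m' : ZMod n → MvPolynomial (Fin 4) K) : Submodule K (MvPolynomial (Fin 4) K) :=
  Submodule.span K (Set.range fun p : Fin 4 × ZMod n × ZMod n => X p.1 * cofF l m m' p.2.1 p.2.2)

/-- The linear forms `span_K {X t}`. [this crux] -/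
def linL (K : Type*) [Field K] : Submodule K (MvPolynomial (Fin 4) K) :=
  Submodule.span K (Set.range (X : Fin 4 → MvPolynomial (Fin 4) K))

end defs

section chain

variable {K : Type*} [Field K] {n : ℕ} [NeZero n] (l m m' : ZMod n → MvPolynomial (Fin 4) K)

/-- Linear multiples of cofactors lie in the tangent span. [this crux] -/
theorem lin_mul_cofF_mem {lam : MvPolynomial (Fin 4) K} (hlam : lam ∈ linL K) (i j : ZMod n) :
    lam * cofF l m m' i j ∈ tanV l m m' := by
  induction hlam using Submodule.span_induction with
  | mem x hx =>
    obtain ⟨t, rfl⟩ := hx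
    exact Submodule.subset_span ⟨(t, i, j), rfl⟩
  | zero => rw [zero_mul]; exact Submodule.zero_mem _
  | add x y _ _ hx hy => rw [add_mul]; exact Submodule.add_mem _ hx hy
  | smul c x _ hx => rw [smul_mul_assoc]; exact Submodule.smul_mem _ c hx

/-- Halving in the tangent span: from `2 · x = y ∈ V` conclude `x ∈ V`. [this crux] -/
theorem mem_of_two_mul_eq (h2 : (2 : K) ≠ 0) {V : Submodule K (MvPolynomial (Fin 4) K)}
    {x y : MvPolynomial (Fin 4) K} (hy : y ∈ V) (h : 2 * x = y) : x ∈ V := by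
  have hx : x = (2 : K)⁻¹ • y := by
    rw [← h, show (2 : MvPolynomial (Fin 4) K) * x = (2 : K) • x by
      rw [MvPolynomial.smul_eq_C_mul, map_ofNat], inv_smul_smul₀ h2]
  rw [hx]
  exact Submodule.smul_mem _ _ hy

/-- A product with a combination of four given forms lies in `V` if the four products do.
[this crux] -/
theorem mul_mem_of_span_four {V : Submodule K (MvPolynomial (Fin 4) K)}
    {f₁ f₂ f₃ f₄ x lam : MvPolynomial (Fin 4) K}
    (h₁ : f₁ * x ∈ V) (h₂ : f₂ * x ∈ V) (h₃ : f₃ * x ∈ V) (h₄ : f₄ * x ∈ V)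
    (hlam : lam ∈ Submodule.span K ({f₁, f₂, f₃, f₄} : Set (MvPolynomial (Fin 4) K))) :
    lam * x ∈ V := by
  induction hlam using Submodule.span_induction with
  | mem y hy =>
    simp only [Set.mem_insert_iff, Set.mem_singleton_iff] at hy
    rcases hy with rfl | rfl | rfl | rfl <;> assumption
  | zero => rw [zero_mul]; exact Submodule.zero_mem _
  | add y z _ _ hy hz => rw [add_mul]; exact Submodule.add_mem _ hy hz
  | smul c y _ hy => rw [smul_mul_assoc]; exact Submodule.smul_mem _ c hy

/-- The cofactor formula in window form: `cofF (q+e) q = Tw q e + Sw (q+e) (n-e)` for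
`1 ≤ e ≤ n-1` (`n ≥ 3`). [this crux] -/
theorem cofF_eq_Tw_add_Sw (hn3 : 3 ≤ n) (q : ZMod n) (e : ℕ) (he1 : 1 ≤ e) (hen : e + 1 ≤ n) :
    cofF l m m' (q + (e : ZMod n)) q = Tw l m m' q e + Sw l m m' (q + (e : ZMod n)) (n - e) := by
  unfold cofF
  rw [subperm_ne_ne_eq_Tw_add_Sw l m m' hn3 q (k := n - e - 1) (by omega) he1,
    show n - e - 1 + 1 = n - e by omega]

/-- The diagonal cofactor: `cofF q q = K(q+1, n-1) = Tw q 0`. [this crux] -/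
theorem cofF_diag (hn3 : 3 ≤ n) (q : ZMod n) : cofF l m m' q q = Tw l m m' q 0 := by
  unfold cofF
  rw [subperm_ne_ne_eq_kont l m m' hn3, Tw_zero]

/-- **Clockwise membership chain.**  For `2 ≠ 0` in `K`, linear forms `l m m'`, and the span
hypothesis on the four special multipliers, every linear multiple of a clockwise pure product of
even string length `2e'+2 ≤ n-3` lies in the tangent span. [this crux] -/
theorem lin_mul_Tw_mem (hn3 : 3 ≤ n) (h2 : (2 : K) ≠ 0)
    (hl : ∀ r, l r ∈ linL K) (hm : ∀ r, m r ∈ linL K) (hm' : ∀ r, m' r ∈ linL K)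
    (hspan : ∀ (q : ZMod n) (e : ℕ), 2 ≤ e → e + 3 ≤ n →
      linL K ≤ Submodule.span K ({l (q + (e : ZMod n)), l q, m' (q + (e : ZMod n)), m' (q + 1)} :
        Set (MvPolynomial (Fin 4) K))) :
    ∀ e' : ℕ, 2 * e' + 2 + 3 ≤ n → ∀ (q : ZMod n) (lam : MvPolynomial (Fin 4) K), lam ∈ linL K →
      lam * Tw l m m' q (2 * e' + 2) ∈ tanV l m m' := by
  intro e'
  induction e' with
  | zero =>
    intro hn q lam hlam
    -- e = 2: the window `[q, q+2]`; cofactors around it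
    have F1 : cofF l m m' (q + 1) q = Tw l m m' q 1 + Sw l m m' (q + 1) (n - 1) := by
      simpa using cofF_eq_Tw_add_Sw l m m' hn3 q 1 le_rfl (by omega)
    have F2 : cofF l m m' (q + 2) q = Tw l m m' q 2 + Sw l m m' (q + 2) (n - 2) := by
      simpa using cofF_eq_Tw_add_Sw l m m' hn3 q 2 (by norm_num) (by omega)
    have F3 : cofF l m m' (q + 3) q = Tw l m m' q 3 + Sw l m m' (q + 3) (n - 3) := by
      simpa using cofF_eq_Tw_add_Sw l m m' hn3 q 3 (by norm_num) (by omega)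
    have F0 : cofF l m m' q q = Tw l m m' q 0 := cofF_diag l m m' hn3 q
    have Fm : cofF l m m' (q + 2) (q - 1) = Tw l m m' (q - 1) 3 + Sw l m m' (q + 2) (n - 3) := by
      have := cofF_eq_Tw_add_Sw l m m' hn3 (q - 1) 3 (by norm_num) (by omega)
      rw [show q - 1 + ((3 : ℕ) : ZMod n) = q + 2 by push_cast; ring] at this
      exact this
    have Fp : cofF l m m' (q + 2) (q + 1) = Tw l m m' (q + 1) 1 + Sw l m m' (q + 2) (n - 1) := by
      have := cofF_eq_Tw_add_Sw l m m' hn3 (q + 1) 1 le_rfl (by omega)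
      rw [show q + 1 + ((1 : ℕ) : ZMod n) = q + 2 by push_cast; ring] at this
      exact this
    have Fd : cofF l m m' (q + 2) (q + 2) = Tw l m m' (q + 2) 0 := cofF_diag l m m' hn3 _
    -- the identities, with numerals normalised
    have E2a : m (q + 1) * Tw l m m' q 1 = l (q + 2) * Tw l m m' q 2 + m' (q + 3) * Tw l m m' q 3 := by
      simpa using Tw_rowRec l m m' q 1 (by omega)
    have E2b : m q * Tw l m m' q 0 = l (q + 1) * Tw l m m' q 1 + m' (q + 2) * Tw l m m' q 2 := by
      simpa using Tw_rowRec l m m' q 0 (by omega)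
    have E1a : m' (q + 3) * Sw l m m' (q + 3) (n - 3) =
        l (q + 2) * Sw l m m' (q + 2) (n - 2) + m (q + 1) * Sw l m m' (q + 1) (n - 1) := by
      have := Sw_rowRec l m m' (q + 3) (n - 3) (by omega)
      rw [show (q + 3 - 1 : ZMod n) = q + 2 by ring, show (q + 3 - 2 : ZMod n) = q + 1 by ring,
        show n - 3 + 1 = n - 2 by omega, show n - 3 + 2 = n - 1 by omega] at this
      exact this
    have E1b : m' (q + 2) * Sw l m m' (q + 2) (n - 2) = l (q + 1) * Sw l m m' (q + 1) (n - 1) := by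
      have := Sw_rowRec_top l m m' (by omega) (q + 2)
      rw [show (q + 2 - 1 : ZMod n) = q + 1 by ring] at this
      exact this
    have E4a : m q * Tw l m m' (q + 1) 1 = l q * Tw l m m' q 2 + m' q * Tw l m m' (q - 1) 3 := by
      have := Tw_colRec l m m' (q + 1) 1 (by omega)
      rw [show (q + 1 - 1 : ZMod n) = q by ring, show (q + 1 - 2 : ZMod n) = q - 1 by ring] at this
      exact this
    have E4b : m (q + 1) * Tw l m m' (q + 2) 0 = l (q + 1) * Tw l m m' (q + 1) 1 + m' (q + 1) * Tw l m m' q 2 := by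
      have := Tw_colRec l m m' (q + 2) 0 (by omega)
      rw [show (q + 2 - 1 : ZMod n) = q + 1 by ring, show (q + 2 - 2 : ZMod n) = q by ring] at this
      exact this
    have E3a : m' q * Sw l m m' (q + 2) (n - 3) =
        l q * Sw l m m' (q + 2) (n - 2) + m q * Sw l m m' (q + 2) (n - 1) := by
      have := Sw_colRec l m m' (q + 2) (n - 3) (by omega)
      rw [show q + 2 + ((n - 3 + 1 : ℕ) : ZMod n) = q by
          rw [show n - 3 + 1 = n - 2 by omega, Nat.cast_sub (by omega), ZMod.natCast_self]
          push_cast; ring,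
        show n - 3 + 1 = n - 2 by omega, show n - 3 + 2 = n - 1 by omega] at this
      exact this
    have E3b : m' (q + 1) * Sw l m m' (q + 2) (n - 2) = l (q + 1) * Sw l m m' (q + 2) (n - 1) := by
      have := Sw_colRec_top l m m' (by omega) (q + 2)
      rw [show (q + 2 - 1 : ZMod n) = q + 1 by ring] at this
      exact this
    -- the four special multiples
    have hA1 : l (q + 2) * Tw l m m' q 2 ∈ tanV l m m' := by
      refine mem_of_two_mul_eq h2 (Submodule.sub_mem _ (Submodule.add_mem _
        (lin_mul_cofF_mem l m m' (hl (q + 2)) (q + 2) q)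
        (lin_mul_cofF_mem l m m' (hm (q + 1)) (q + 1) q))
        (lin_mul_cofF_mem l m m' (hm' (q + 3)) (q + 3) q)) ?_
      rw [F2, F1, F3]
      linear_combination -E2a + E1a
    have hA2 : l q * Tw l m m' q 2 ∈ tanV l m m' := by
      refine mem_of_two_mul_eq h2 (Submodule.sub_mem _ (Submodule.add_mem _
        (lin_mul_cofF_mem l m m' (hl q) (q + 2) q)
        (lin_mul_cofF_mem l m m' (hm q) (q + 2) (q + 1)))
        (lin_mul_cofF_mem l m m' (hm' q) (q + 2) (q - 1))) ?_
      rw [F2, Fp, Fm]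
      linear_combination -E4a + E3a
    have hB : l (q + 1) * Tw l m m' q 1 ∈ tanV l m m' := by
      refine mem_of_two_mul_eq h2 (Submodule.sub_mem _ (Submodule.add_mem _
        (lin_mul_cofF_mem l m m' (hl (q + 1)) (q + 1) q)
        (lin_mul_cofF_mem l m m' (hm q) q q))
        (lin_mul_cofF_mem l m m' (hm' (q + 2)) (q + 2) q)) ?_
      rw [F1, F0, F2]
      linear_combination -E2b + E1b
    have hA3 : m' (q + 2) * Tw l m m' q 2 ∈ tanV l m m' := by
      have : m' (q + 2) * Tw l m m' q 2 = m q * cofF l m m' q q - l (q + 1) * Tw l m m' q 1 := by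
        rw [F0]; linear_combination -E2b
      rw [this]
      exact Submodule.sub_mem _ (lin_mul_cofF_mem l m m' (hm q) q q) hB
    have hC : l (q + 1) * Tw l m m' (q + 1) 1 ∈ tanV l m m' := by
      refine mem_of_two_mul_eq h2 (Submodule.sub_mem _ (Submodule.add_mem _
        (lin_mul_cofF_mem l m m' (hl (q + 1)) (q + 2) (q + 1))
        (lin_mul_cofF_mem l m m' (hm (q + 1)) (q + 2) (q + 2)))
        (lin_mul_cofF_mem l m m' (hm' (q + 1)) (q + 2) q)) ?_
      rw [Fp, Fd, F2]
      linear_combination -E4b + E3b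
    have hA4 : m' (q + 1) * Tw l m m' q 2 ∈ tanV l m m' := by
      have : m' (q + 1) * Tw l m m' q 2 = m (q + 1) * cofF l m m' (q + 2) (q + 2) - l (q + 1) * Tw l m m' (q + 1) 1 := by
        rw [Fd]; linear_combination -E4b
      rw [this]
      exact Submodule.sub_mem _ (lin_mul_cofF_mem l m m' (hm (q + 1)) _ _) hC
    have hsp := hspan q 2 le_rfl (by omega) hlam
    simp only [Nat.cast_ofNat] at hsp
    exact mul_mem_of_span_four hA1 hA2 hA3 hA4 hsp
  | succ e' ih =>
    intro hn q lam hlam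
    set e := 2 * e' + 2 with he
    have hee : 2 * (e' + 1) + 2 = e + 2 := by omega
    rw [hee] at hn ⊢
    have ih' := ih (by omega)
    -- cofactors around the window `[q, q+e+2]`
    have F : ∀ d : ℕ, 1 ≤ d → d + 1 ≤ n → ∀ q' : ZMod n,
        cofF l m m' (q' + (d : ZMod n)) q' = Tw l m m' q' d + Sw l m m' (q' + (d : ZMod n)) (n - d) :=
      fun d hd1 hdn q' => cofF_eq_Tw_add_Sw l m m' hn3 q' d hd1 hdn
    -- (A1) l_{q+e+2}: rows q+e+1, q+e+2, q+e+3 of column q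
    have E2a := Tw_rowRec l m m' q (e + 1) (by omega)
    have E1a := Sw_rowRec l m m' (q + ((e + 3 : ℕ) : ZMod n)) (n - e - 3) (by omega)
    have hA1 : l (q + ((e + 2 : ℕ) : ZMod n)) * Tw l m m' q (e + 2) ∈ tanV l m m' := by
      refine mem_of_two_mul_eq h2 (Submodule.sub_mem _ (Submodule.add_mem _
        (lin_mul_cofF_mem l m m' (hl (q + ((e + 2 : ℕ) : ZMod n))) (q + ((e + 2 : ℕ) : ZMod n)) q)
        (lin_mul_cofF_mem l m m' (hm (q + ((e + 1 : ℕ) : ZMod n))) (q + ((e + 1 : ℕ) : ZMod n)) q))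
        (lin_mul_cofF_mem l m m' (hm' (q + ((e + 3 : ℕ) : ZMod n))) (q + ((e + 3 : ℕ) : ZMod n)) q)) ?_
      rw [F (e + 2) (by omega) (by omega), F (e + 1) (by omega) (by omega), F (e + 3) (by omega) (by omega)]
      rw [show q + ((e + 3 : ℕ) : ZMod n) - 1 = q + ((e + 2 : ℕ) : ZMod n) by push_cast; ring,
        show q + ((e + 3 : ℕ) : ZMod n) - 2 = q + ((e + 1 : ℕ) : ZMod n) by push_cast; ring,
        show n - e - 3 + 1 = n - (e + 2) by omega, show n - e - 3 + 2 = n - (e + 1) by omega,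
        show n - e - 3 = n - (e + 3) by omega] at E1a
      rw [show q + ((e + 1 + 1 : ℕ) : ZMod n) = q + ((e + 2 : ℕ) : ZMod n) by push_cast; ring,
        show q + ((e + 1 + 2 : ℕ) : ZMod n) = q + ((e + 3 : ℕ) : ZMod n) by push_cast; ring,
        show e + 1 + 1 = e + 2 by ring, show e + 1 + 2 = e + 3 by ring] at E2a
      linear_combination -E2a + E1a
    -- (A2) l_q: columns q-1, q, q+1 of row q+e+2
    have E4a := Tw_colRec l m m' (q + 1) (e + 1) (by omega)
    have E3a := Sw_colRec l m m' (q + ((e + 2 : ℕ) : ZMod n)) (n - e - 3) (by omega)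
    have hA2 : l q * Tw l m m' q (e + 2) ∈ tanV l m m' := by
      have Fm : cofF l m m' (q + ((e + 2 : ℕ) : ZMod n)) (q - 1) =
          Tw l m m' (q - 1) (e + 3) + Sw l m m' (q + ((e + 2 : ℕ) : ZMod n)) (n - (e + 3)) := by
        have := F (e + 3) (by omega) (by omega) (q - 1)
        rwa [show q - 1 + ((e + 3 : ℕ) : ZMod n) = q + ((e + 2 : ℕ) : ZMod n) by push_cast; ring] at this
      have Fp : cofF l m m' (q + ((e + 2 : ℕ) : ZMod n)) (q + 1) =
          Tw l m m' (q + 1) (e + 1) + Sw l m m' (q + ((e + 2 : ℕ) : ZMod n)) (n - (e + 1)) := by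
        have := F (e + 1) (by omega) (by omega) (q + 1)
        rwa [show q + 1 + ((e + 1 : ℕ) : ZMod n) = q + ((e + 2 : ℕ) : ZMod n) by push_cast; ring] at this
      refine mem_of_two_mul_eq h2 (Submodule.sub_mem _ (Submodule.add_mem _
        (lin_mul_cofF_mem l m m' (hl q) (q + ((e + 2 : ℕ) : ZMod n)) q)
        (lin_mul_cofF_mem l m m' (hm q) (q + ((e + 2 : ℕ) : ZMod n)) (q + 1)))
        (lin_mul_cofF_mem l m m' (hm' q) (q + ((e + 2 : ℕ) : ZMod n)) (q - 1))) ?_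
      rw [F (e + 2) (by omega) (by omega), Fp, Fm]
      rw [show q + 1 - 1 = q by ring, show q + 1 - 2 = q - 1 by ring,
        show e + 1 + 1 = e + 2 by ring, show e + 1 + 2 = e + 3 by ring] at E4a
      rw [show q + ((e + 2 : ℕ) : ZMod n) + ((n - e - 3 + 1 : ℕ) : ZMod n) = q by
          rw [show n - e - 3 + 1 = n - (e + 2) by omega, Nat.cast_sub (by omega), ZMod.natCast_self]
          push_cast; ring,
        show n - e - 3 + 1 = n - (e + 2) by omega, show n - e - 3 + 2 = n - (e + 1) by omega,
        show n - e - 3 = n - (e + 3) by omega] at E3a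
      linear_combination -E4a + E3a
    -- (A3) m'_{q+e+2}: (E2) at length e, the IH, and (R2) at (q+e+2, q)
    have E2b := Tw_rowRec l m m' q e (by omega)
    have E1b := Sw_rowRec l m m' (q + ((e + 2 : ℕ) : ZMod n)) (n - e - 2) (by omega)
    have hB : l (q + ((e + 1 : ℕ) : ZMod n)) * Tw l m m' q (e + 1) ∈ tanV l m m' := by
      refine mem_of_two_mul_eq h2 (Submodule.sub_mem _ (Submodule.add_mem _
        (lin_mul_cofF_mem l m m' (hl (q + ((e + 1 : ℕ) : ZMod n))) (q + ((e + 1 : ℕ) : ZMod n)) q)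
        (lin_mul_cofF_mem l m m' (hm (q + (e : ZMod n))) (q + (e : ZMod n)) q))
        (lin_mul_cofF_mem l m m' (hm' (q + ((e + 2 : ℕ) : ZMod n))) (q + ((e + 2 : ℕ) : ZMod n)) q)) ?_
      rw [F (e + 1) (by omega) (by omega), F e (by omega) (by omega), F (e + 2) (by omega) (by omega)]
      rw [show q + ((e + 2 : ℕ) : ZMod n) - 1 = q + ((e + 1 : ℕ) : ZMod n) by push_cast; ring,
        show q + ((e + 2 : ℕ) : ZMod n) - 2 = q + (e : ZMod n) by push_cast; ring,
        show n - e - 2 + 1 = n - (e + 1) by omega, show n - e - 2 + 2 = n - e by omega,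
        show n - e - 2 = n - (e + 2) by omega] at E1b
      linear_combination -E2b + E1b
    have hA3 : m' (q + ((e + 2 : ℕ) : ZMod n)) * Tw l m m' q (e + 2) ∈ tanV l m m' := by
      have : m' (q + ((e + 2 : ℕ) : ZMod n)) * Tw l m m' q (e + 2) =
          m (q + (e : ZMod n)) * Tw l m m' q e - l (q + ((e + 1 : ℕ) : ZMod n)) * Tw l m m' q (e + 1) := by
        linear_combination -E2b
      rw [this]
      exact Submodule.sub_mem _ (ih' q _ (hm _)) hB
    -- (A4) m'_{q+1}: (E4) at (q+e+2, q+2), the IH at q+2, and (C2) at (q+e+2, q)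
    have E4b := Tw_colRec l m m' (q + ((2 : ℕ) : ZMod n)) e (by omega)
    have E3b := Sw_colRec l m m' (q + ((e + 2 : ℕ) : ZMod n)) (n - e - 2) (by omega)
    have hq2 : q + ((2 : ℕ) : ZMod n) + (e : ZMod n) = q + ((e + 2 : ℕ) : ZMod n) := by push_cast; ring
    have hC : l (q + 1) * Tw l m m' (q + 1) (e + 1) ∈ tanV l m m' := by
      have Fp : cofF l m m' (q + ((e + 2 : ℕ) : ZMod n)) (q + 1) =
          Tw l m m' (q + 1) (e + 1) + Sw l m m' (q + ((e + 2 : ℕ) : ZMod n)) (n - (e + 1)) := by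
        have := F (e + 1) (by omega) (by omega) (q + 1)
        rwa [show q + 1 + ((e + 1 : ℕ) : ZMod n) = q + ((e + 2 : ℕ) : ZMod n) by push_cast; ring] at this
      have Fpp : cofF l m m' (q + ((e + 2 : ℕ) : ZMod n)) (q + ((2 : ℕ) : ZMod n)) =
          Tw l m m' (q + ((2 : ℕ) : ZMod n)) e + Sw l m m' (q + ((e + 2 : ℕ) : ZMod n)) (n - e) := by
        have := F e (by omega) (by omega) (q + ((2 : ℕ) : ZMod n))
        rwa [hq2] at this
      refine mem_of_two_mul_eq h2 (Submodule.sub_mem _ (Submodule.add_mem _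
        (lin_mul_cofF_mem l m m' (hl (q + 1)) (q + ((e + 2 : ℕ) : ZMod n)) (q + 1))
        (lin_mul_cofF_mem l m m' (hm (q + 1)) (q + ((e + 2 : ℕ) : ZMod n)) (q + ((2 : ℕ) : ZMod n))))
        (lin_mul_cofF_mem l m m' (hm' (q + 1)) (q + ((e + 2 : ℕ) : ZMod n)) q)) ?_
      rw [Fp, Fpp, F (e + 2) (by omega) (by omega)]
      rw [show q + ((2 : ℕ) : ZMod n) - 1 = q + 1 by push_cast; ring,
        show q + ((2 : ℕ) : ZMod n) - 2 = q by push_cast; ring] at E4b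
      rw [show q + ((e + 2 : ℕ) : ZMod n) + ((n - e - 2 + 1 : ℕ) : ZMod n) = q + 1 by
          rw [show n - e - 2 + 1 = n - (e + 1) by omega, Nat.cast_sub (by omega), ZMod.natCast_self]
          push_cast; ring,
        show n - e - 2 + 1 = n - (e + 1) by omega, show n - e - 2 + 2 = n - e by omega,
        show n - e - 2 = n - (e + 2) by omega] at E3b
      linear_combination -E4b + E3b
    have hA4 : m' (q + 1) * Tw l m m' q (e + 2) ∈ tanV l m m' := by
      have : m' (q + 1) * Tw l m m' q (e + 2) =
          m (q + 1) * Tw l m m' (q + ((2 : ℕ) : ZMod n)) e - l (q + 1) * Tw l m m' (q + 1) (e + 1) := by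
        rw [show q + ((2 : ℕ) : ZMod n) - 1 = q + 1 by push_cast; ring,
          show q + ((2 : ℕ) : ZMod n) - 2 = q by push_cast; ring] at E4b
        linear_combination -E4b
      rw [this]
      exact Submodule.sub_mem _ (ih' _ _ (hm _)) hC
    exact mul_mem_of_span_four hA1 hA2 hA3 hA4 (hspan q (e + 2) (by omega) (by omega) hlam)

end chain

end

end Summit.ValiantsHypothesis.ValiantsHypothesis.Theorems.ValuativeFlip
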